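import Literature.AlgebraicGeometry.HodgeTheory.ProductFactorsHodgeDescent
import HarnessLib

/-!
# A dominant morphism between smooth projective complex varieties is surjective: the Hodge
# conjecture, `GHC`, `C`, geometric coniveau and the Betti/Hodge numbers descend along DOMINANT morphisms

Family `hodge`, layer `Literature/AlgebraicGeometry/HodgeTheory`; lane `lit-hodgefound` (Track 2 foundations,
Layer A1). THEOREMS ONLY (no definition, no named fact; D-0026).

A morphism `g : X ⟶ W` of `ℂ`-schemes with `X` proper and `W` separated over `ℂ` is universally closed
(`g ≫ (W → Spec ℂ) = (X → Spec ℂ)`, cancellation `UniversallyClosed.of_comp_of_isSeparated`, Hartshorne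
II Cor. 4.8 (e)), so its image is closed; if `g` is moreover dominant the image is dense, hence `g` is
surjective (Mathlib `surjective_of_isDominant_of_isClosed_range`). For smooth projective `X`, `W` the
tree's descent theorems along SURJECTIVE morphisms (Voisin I Lemma 7.28 with the wedge kept:
`SurjectiveDescent.hodgeConjectureFor_of_surjective`, `generalHodgePropertyFor_of_surjective`,
`kunnethComponents_algebraic_of_surjective`, `mem_supportedClasses_of_map_mem_of_surjective'`,
`finrank_bettiCohomology_le_of_surjective`, `BettiUniverse.hodgeNumber_hodge_le_of_surjective`,
`complexBetti_map_injective_of_surjective`) therefore hold for every DOMINANT `g` (Mathlib's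
`AlgebraicGeometry.IsDominant g.left`: dense image), the form in which dominations by rational maps
present themselves after resolving indeterminacies.

* §1 **`IsSmoothProjective.universallyClosed_left`**, **`IsSmoothProjective.surjective_of_isDominant`**.
* §2 `complexBetti_map_injective_of_isDominant` (`g^*` injective), `dim_le_of_isDominant`,
  **`hodgeConjectureFor_of_isDominant`**, **`generalHodgePropertyFor_of_isDominant`**,
  **`kunnethComponents_algebraic_of_isDominant`**, `mem_supportedClasses_of_map_mem_of_isDominant`,
  `mem_algebraicClasses_of_map_mem_of_isDominant`, `finrank_bettiCohomology_le_of_isDominant`,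
  `BettiUniverse.hodgeNumber_hodge_le_of_isDominant`.
* §3 `generalHodgePropertyFor_of_isDominant_of_cmGeneralHodgeHypothesisAt` — a variety dominated by a CM
  abelian variety `A` satisfying the tree's `CMGeneralHodgeHypothesisAt A` satisfies `GHC` in every `(i, r)`.

## References

* [Hartshorne1977] R. Hartshorne, Algebraic Geometry, Springer 1977, II Cor. 4.8 (e), Ex. 4.4, Ex. 3.15.
* [Voisin2002] [VoisinHodgeI2002] C. Voisin, Hodge Theory and Complex Algebraic Geometry I, CUP 2002,
  §7.3.2 Lemma 7.28 and Remark 7.29.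
* [Arapura2006] D. Arapura, Motivation for Hodge cycles, Adv. Math. 207 (2006), §1 Cor. 1.2, §4 Lemma 4.2.
* [Kahn2020] B. Kahn, Zeta and L-functions of varieties and motives, CUP 2020, §6.9 Lemma 6.30 (2).
* [GrothendieckTopology1969] A. Grothendieck, Topology 8 (1969), pp. 299–301.
* [Abdulali2005CMHodge] S. Abdulali, Hodge structures of CM-type, J. Ramanujan Math. Soc. 20 (2005), §3 Thm. 4.
-/

noncomputable section

open CategoryTheory AlgebraicGeometry MonoidalCategory
open Literature.AlgebraicTopology.SingularHomology
open Literature.AlgebraicGeometry.Motives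

namespace Literature.AlgebraicGeometry.HodgeTheory

variable {n m : ℕ} {X W : SchemeOver ℂ}

/-! ### §1 Dominant ⟹ surjective for morphisms from a smooth projective variety -/

/-- **A morphism from a smooth projective variety to a smooth projective variety is universally
closed** (`g ≫ (W → Spec ℂ) = (X → Spec ℂ)` is proper and `W → Spec ℂ` is separated).
[cite: Hartshorne1977, II Cor. 4.8 (e)] -/
theorem _root_.Literature.AlgebraicGeometry.Motives.IsSmoothProjective.universallyClosed_left
    (hX : IsSmoothProjective n X) (hW : IsSmoothProjective m W) (g : X ⟶ W) : UniversallyClosed g.left := by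
  haveI : IsProper X.hom := hX.isProper_holds
  haveI : IsProper W.hom := hW.isProper_holds
  haveI : UniversallyClosed (g.left ≫ W.hom) := by rw [Over.w g]; infer_instance
  exact UniversallyClosed.of_comp_of_isSeparated g.left W.hom

/-- **A DOMINANT morphism `g : X ⟶ W` between smooth projective complex varieties is surjective** (its
image is closed — `g` is universally closed — and dense). [cite: Hartshorne1977, II Cor. 4.8 (e) and Ex. 4.4]
[cite: Hartshorne1977, II Ex. 3.15] -/
theorem _root_.Literature.AlgebraicGeometry.Motives.IsSmoothProjective.surjective_of_isDominant
    (hX : IsSmoothProjective n X) (hW : IsSmoothProjective m W) (g : X ⟶ W) [IsDominant g.left] :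
    Surjective g.left := by
  haveI := hX.universallyClosed_left hW g
  exact surjective_of_isDominant_of_isClosed_range g.left g.left.isClosedMap.isClosed_range

/-! ### §2 Descent along dominant morphisms -/

section Dominant

/-- **`g^* : Hᵏ(W(ℂ); ℂ) → Hᵏ(X(ℂ); ℂ)` is injective for `g` dominant** (Voisin I Lemma 7.28).
[cite: Voisin2002, §7.3.2 Lemma 7.28] -/
theorem complexBetti_map_injective_of_isDominant (hX : IsSmoothProjective n X) (hW : IsSmoothProjective m W)
    (g : X ⟶ W) [IsDominant g.left] (k : ℕ) :
    Function.Injective (complexBetti.map g k) := by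
  haveI := hX.surjective_of_isDominant hW g
  exact complexBetti_map_injective_of_surjective hW hX g k

/-- **`dim W ≤ dim X` for `g : X ⟶ W` dominant.** [cite: Voisin2002, §7.3.2 Lemma 7.28] -/
theorem dim_le_of_isDominant (hX : IsSmoothProjective n X) (hW : IsSmoothProjective m W)
    (g : X ⟶ W) [IsDominant g.left] : m ≤ n := by
  haveI := hX.surjective_of_isDominant hW g
  exact dim_le_of_surjective hX hW g

/-- **The Hodge conjecture descends along dominant morphisms: `HC(X) ⟹ HC(W)`.**
[cite: Arapura2006, §1 Cor. 1.2 and §4 Lemma 4.2] [cite: Voisin2002, §7.3.2 Lemma 7.28 and Remark 7.29] -/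
theorem hodgeConjectureFor_of_isDominant (hX : IsSmoothProjective n X) (hW : IsSmoothProjective m W)
    (g : X ⟶ W) [IsDominant g.left]
    (h : HodgeConjectureFor n X) : HodgeConjectureFor m W := by
  haveI := hX.surjective_of_isDominant hW g
  exact SurjectiveDescent.hodgeConjectureFor_of_surjective hX hW g h

/-- **Grothendieck's amended generalized Hodge conjecture descends along dominant morphisms:
`GHC(X, i, r) ⟹ GHC(W, i, r)`.** [cite: Arapura2006, §4 Lemma 4.2 (clause GHC) and §1 Cor. 1.2]
[cite: GrothendieckTopology1969, p. 300] -/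
theorem generalHodgePropertyFor_of_isDominant (hX : IsSmoothProjective n X) (hW : IsSmoothProjective m W)
    (g : X ⟶ W) [IsDominant g.left]
    {i r : ℕ} (h : GeneralHodgePropertyFor n X i r) : GeneralHodgePropertyFor m W i r := by
  haveI := hX.surjective_of_isDominant hW g
  exact generalHodgePropertyFor_of_surjective hX hW g h

/-- **The Künneth standard conjecture descends along dominant morphisms: `C(X) ⟹ C(W)`.**
[cite: Kahn2020, §6.9 Lemma 6.30 (2)] [cite: Voisin2002, §7.3.2 Lemma 7.28 and Remark 7.29] -/
theorem kunnethComponents_algebraic_of_isDominant (hX : IsSmoothProjective n X) (hW : IsSmoothProjective m W)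
    (g : X ⟶ W) [IsDominant g.left]
    (hCX : ∀ (πX : Fin (2 * n + 1) → complexBetti (X ⊗ X) (2 * n)),
      (∀ i : Fin (2 * n + 1), πX i ∈ kunnethPiece X X (show (2 * n - (i : ℕ)) + i = 2 * n by omega)) →
      ∑ i, πX i = diagonalClass hX → ∀ i, πX i ∈ algebraicClasses (X ⊗ X) n)
    {πW : Fin (2 * m + 1) → complexBetti (W ⊗ W) (2 * m)}
    (hπW : ∀ i : Fin (2 * m + 1), πW i ∈ kunnethPiece W W (show (2 * m - (i : ℕ)) + i = 2 * m by omega))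
    (hΔW : ∑ i, πW i = diagonalClass hW) (i : Fin (2 * m + 1)) :
    πW i ∈ algebraicClasses (W ⊗ W) m := by
  haveI := hX.surjective_of_isDominant hW g
  exact kunnethComponents_algebraic_of_surjective hX hW g hCX hπW hΔW i

/-- **Geometric coniveau descends along dominant morphisms: `g^* x ∈ Nᶜ Hᵏ(X) ⟹ x ∈ Nᶜ Hᵏ(W)`.**
[cite: Voisin2002, §7.3.2 Lemma 7.28 and Remark 7.29] -/
theorem mem_supportedClasses_of_map_mem_of_isDominant (hX : IsSmoothProjective n X) (hW : IsSmoothProjective m W)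
    (g : X ⟶ W) [IsDominant g.left]
    {k c : ℕ} {x : complexBetti W k}
    (hx : complexBetti.map g k x ∈ supportedClasses X k c) : x ∈ supportedClasses W k c := by
  haveI := hX.surjective_of_isDominant hW g
  exact mem_supportedClasses_of_map_mem_of_surjective' hX hW g hx

/-- **Algebraicity descends along dominant morphisms: `g^* x` algebraic ⟹ `x` algebraic.**
[cite: Voisin2002, §7.3.2 Remark 7.29] -/
theorem mem_algebraicClasses_of_map_mem_of_isDominant (hX : IsSmoothProjective n X) (hW : IsSmoothProjective m W)
    (g : X ⟶ W) [IsDominant g.left]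
    {p : ℕ} {x : complexBetti W (2 * p)}
    (hx : complexBetti.map g (2 * p) x ∈ algebraicClasses X p) : x ∈ algebraicClasses W p := by
  haveI := hX.surjective_of_isDominant hW g
  exact mem_algebraicClasses_of_map_mem_of_surjective' hX hW g hx

/-- **`b_k(W) ≤ b_k(X)` for `g : X ⟶ W` dominant.** [cite: Voisin2002, §7.3.2 Lemma 7.28] -/
theorem finrank_bettiCohomology_le_of_isDominant (hX : IsSmoothProjective n X) (hW : IsSmoothProjective m W)
    (g : X ⟶ W) [IsDominant g.left] (k : ℕ) :
    Module.finrank ℚ (bettiCohomology W k) ≤ Module.finrank ℚ (bettiCohomology X k) := by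
  haveI := hX.surjective_of_isDominant hW g
  exact finrank_bettiCohomology_le_of_surjective hX hW g k

/-- **`h^{p,q}(W) ≤ h^{p,q}(X)` for `g : X ⟶ W` dominant** (model-free Hodge numbers, `p + q = k`).
[cite: Voisin2002, §7.3.2 Lemma 7.28] [cite: VoisinHodgeI2002, §7.3.2 (p. 150)] -/
theorem BettiUniverse.hodgeNumber_hodge_le_of_isDominant (hHD : exists_isReal_hodgeModel)
    (hX : IsSmoothProjective n X) (hW : IsSmoothProjective m W)
    (g : X ⟶ W) [IsDominant g.left] {k p q : ℕ} (hpq : p + q = k) :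
    (BettiUniverse.hodge hHD hW k).hodgeNumber p q ≤ (BettiUniverse.hodge hHD hX k).hodgeNumber p q := by
  haveI := hX.surjective_of_isDominant hW g
  exact BettiUniverse.hodgeNumber_hodge_le_of_surjective hHD hX hW g hpq

end Dominant

/-! ### §3 Varieties dominated by a CM abelian variety -/

/-- **A variety dominated by a CM abelian variety with `GHC_CM` satisfies `GHC`**: for a complex abelian
variety `A` of CM-type satisfying the tree's per-variety hypothesis `CMGeneralHodgeHypothesisAt A`
(Hazama 2002 / Abdulali 2005: `GHC` for CM abelian varieties, granted `HC_CM`) and a dominant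
`g : A ⟶ W` onto a smooth projective `W`, `GHC(W, i, r)` holds for all `(i, r)`.
[cite: Abdulali2005CMHodge, §3 Thm. 4] [cite: Arapura2006, §4 Lemma 4.2 (clause GHC) and §1 Cor. 1.2] -/
theorem generalHodgePropertyFor_of_isDominant_of_cmGeneralHodgeHypothesisAt {A : Motives.AbelianVariety ℂ}
    (h : CMGeneralHodgeHypothesisAt A) (hCM : Milne1999.IsOfCMType A) (hW : IsSmoothProjective m W)
    (g : A.X ⟶ W) [IsDominant g.left] (i r : ℕ) : GeneralHodgePropertyFor m W i r :=
  generalHodgePropertyFor_of_isDominant Motives.AbelianVariety.isSmoothProjective_holds hW g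
    (h.generalHodgePropertyFor hCM i r)

end Literature.AlgebraicGeometry.HodgeTheory

end
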